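import Summits.Ventures.PercRepro.RankLevelSetRuleQSliceStep

/-!
# PercRepro — THE BINOMIAL SUMS OF THE SLICE SUMS, AND THE BORDERLINE SLICE AS AN INEQUALITY BETWEEN TWO PARTIAL ROW SUMS
OF PASCAL'S TRIANGLE (night-1, gen 20; dossier §31.8)

For the slice sums `S_j(q, m) = Σ_{a ≤ m} C(m, a)/C(q+j+a, a+j)`:
* **`slice_binom_sum`** — Pascal iterated: `Σ_{j ≤ N} C(N, j)·S_{j₀+j}(q, m) = S_{j₀}(q, m + N)` (`rhatSliceSum_succ`);
* **`slice_zero_eq_rho`** — `S₀(q, m) = ρ(q+m, m)` with `ρ(n, r) := (Σ_{i ≤ r} C(n, i))/C(n, r)` (`sum_choose_div_choose_eq`);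
* **`border_sub_phiK_eq`** — on the BORDERLINE slice `u = k − 2` (`m = q − k + 2`, `q = m + k − 2`), with
  `L = Σ_{0<j<k} C(2k−2, j)·S_j(q, m)` (the untruncated lower bound of `R̂(q, k, m)`, `rhatSliceL_le_rhat`) and the tail
  `T = Σ_{k ≤ j ≤ 2k−2} C(2k−2, j)·S_j(q, m) ≥ 0`:
  `L − Φ(q+k, q) = 1 + ρ(2q+k, q) − ρ(2q−k+2, q−k+2) − T`.
  (Proof: `L + T = S₀(q, m+2k−2) − S₀(q, m)` by the binomial sum; `S₀(q, q+k) = (Σ_{i ≤ q+k} C(2q+k, i))/C(2q+k, q+k)` and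
  `Φ(q+k, q) = (Σ_{q<i<q+k} C(2q+k, i))/C(2q+k, q+k)` share their denominator, `C(2q+k, q+k) = C(2q+k, q)`, and the difference of
  their numerators is `Σ_{i ≤ q} C(2q+k, i) + C(2q+k, q+k)`.)
Hence the uniform borderline conjecture of record (dossier §28.7: `Φ(q+k, q) ≤ R̂(q, k, q−k+2)` for every `k ≥ 5`, `q ≥ k − 2`)
FOLLOWS FROM the inequality between partial row sums **`1 + ρ(2q+k, q) − ρ(2q−k+2, q−k+2) ≥ T(q, k)`** — whose left side is
`≈ 3(k−1)√π/(4√q)` and whose right side is `≈ C(2k−2, k)·(k/2)!·q^{(1−k)/2}` (the decay `slice_diag_decay`); the calculus of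
`ρ` (numerically: `ρ(n, r) = 1 + (r/(n−r+1))·ρ(n, r−1)`, `ρ(n, r)` is a mediant of `ρ(n−1, r−1)` and `ρ(n−1, r)`, increasing in
`r` and decreasing in `n` for `r ≤ n/2`) is the successor's handle. Twin: mining/night-1/g20/border_rho.py. Axioms: standard.
-/

namespace PercRepro

open Finset

/-- Pascal in a weighted sum: `Σ_{j ≤ N+1} C(N+1, j)·f(j) = Σ_{j ≤ N} C(N, j)·f(j) + Σ_{j ≤ N} C(N, j)·f(j+1)`. -/
lemma sum_choose_succ_mul_weighted (N : ℕ) (f : ℕ → ℚ) :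
    ∑ j ∈ range (N + 1 + 1), ((N + 1).choose j : ℚ) * f j
      = ∑ j ∈ range (N + 1), (N.choose j : ℚ) * f j + ∑ j ∈ range (N + 1), (N.choose j : ℚ) * f (j + 1) := by
  rw [Finset.sum_range_succ' (fun j => ((N + 1).choose j : ℚ) * f j) (N + 1)]
  have h1 : ∀ j ∈ range (N + 1), ((N + 1).choose (j + 1) : ℚ) * f (j + 1)
      = (N.choose j : ℚ) * f (j + 1) + (N.choose (j + 1) : ℚ) * f (j + 1) := by
    intro j _
    rw [Nat.choose_succ_succ']; push_cast; ring
  rw [Finset.sum_congr rfl h1, Finset.sum_add_distrib]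
  have h2 : ∑ j ∈ range (N + 1), (N.choose (j + 1) : ℚ) * f (j + 1) + ((N + 1).choose 0 : ℚ) * f 0
      = ∑ j ∈ range (N + 1), (N.choose j : ℚ) * f j := by
    rw [Finset.sum_range_succ' (fun j => (N.choose j : ℚ) * f j) N,
      Finset.sum_range_succ (fun j => (N.choose (j + 1) : ℚ) * f (j + 1)) N, Nat.choose_succ_self,
      Nat.choose_zero_right, Nat.choose_zero_right]
    push_cast
    ring
  linarith [h2]

/-- **Pascal iterated in the slice sums**: `Σ_{j ≤ N} C(N, j)·S_{j₀+j}(q, m) = S_{j₀}(q, m + N)`. -/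
theorem slice_binom_sum (q m : ℕ) : ∀ (N j₀ : ℕ),
    ∑ j ∈ range (N + 1), (N.choose j : ℚ)
        * ∑ a ∈ range (m + 1), (m.choose a : ℚ) / ((q + (j₀ + j) + a).choose (a + (j₀ + j)) : ℚ)
      = ∑ a ∈ range (m + N + 1), ((m + N).choose a : ℚ) / ((q + j₀ + a).choose (a + j₀) : ℚ) := by
  intro N
  induction N with
  | zero =>
    intro j₀
    simp only [zero_add, Finset.sum_range_one, Nat.choose_zero_right, Nat.cast_one, one_mul, add_zero]
  | succ N ih =>
    intro j₀
    rw [show m + (N + 1) = m + N + 1 by ring, rhatSliceSum_succ, ← ih j₀, ← ih (j₀ + 1),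
      sum_choose_succ_mul_weighted N (fun j => ∑ a ∈ range (m + 1),
        (m.choose a : ℚ) / ((q + (j₀ + j) + a).choose (a + (j₀ + j)) : ℚ))]
    congr 1
    refine Finset.sum_congr rfl (fun j _ => ?_)
    rw [show j₀ + (j + 1) = j₀ + 1 + j by ring]

/-- **`S₀(q, m) = ρ(q+m, m)`**: `Σ_{a ≤ m} C(m, a)/C(q+a, a) = (Σ_{i ≤ m} C(q+m, i))/C(q+m, m)`. -/
lemma slice_zero_eq_rho (q m : ℕ) :
    ∑ a ∈ range (m + 1), (m.choose a : ℚ) / ((q + 0 + a).choose (a + 0) : ℚ)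
      = (∑ i ∈ range (m + 1), ((q + m).choose i : ℚ)) / ((q + m).choose m : ℚ) := by
  rw [← sum_choose_div_choose_eq]
  refine Finset.sum_congr rfl (fun a _ => ?_)
  rw [add_zero, add_zero]

/-- The numerator identity: `Σ_{i ≤ q+k} C(n, i) − Σ_{q < i < q+k} C(n, i) = Σ_{i ≤ q} C(n, i) + C(n, q+k)`. -/
lemma sum_choose_split_middle (n q k : ℕ) (hk : 1 ≤ k) :
    ∑ i ∈ range (q + k + 1), (n.choose i : ℚ) - ∑ i ∈ Ioo q (q + k), (n.choose i : ℚ)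
      = ∑ i ∈ range (q + 1), (n.choose i : ℚ) + (n.choose (q + k) : ℚ) := by
  rw [Finset.sum_range_succ, show q + k = q + 1 + (k - 1) by omega, Finset.sum_range_add, sum_Ioo_nat,
    show q + 1 + (k - 1) - (q + 1) = k - 1 by omega]
  have : ∑ i ∈ range (k - 1), (n.choose (q + 1 + i) : ℚ) = ∑ i ∈ range (k - 1), (n.choose (q + 1 + i) : ℚ) := rfl
  rw [show q + 1 + (k - 1) = q + k by omega]
  ring

/-- **THE BORDERLINE SLICE AS TWO PARTIAL ROW SUMS**: on the slice `u = k − 2` (`k = k' + 2`, `q = m + k'`), with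
`L = Σ_{0<j<k} C(2k−2, j)·S_j(q, m)` and the tail `T = Σ_{k ≤ j ≤ 2k−2} C(2k−2, j)·S_j(q, m)`:
`L − Φ(q+k, q) = 1 + ρ(2q+k, q) − ρ(2q−k+2, q−k+2) − T`, `ρ(n, r) = (Σ_{i ≤ r} C(n, i))/C(n, r)`. -/
theorem border_sub_phiK_eq (m k' : ℕ) :
    (∑ j ∈ range (k' + 1), ((2 * k' + 2).choose (j + 1) : ℚ)
        * ∑ a ∈ range (m + 1), (m.choose a : ℚ) / ((m + k' + (j + 1) + a).choose (a + (j + 1)) : ℚ))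
      - phiK (m + k' + (k' + 2)) (m + k')
      = 1 + (∑ i ∈ range (m + k' + 1), ((2 * m + 3 * k' + 2).choose i : ℚ)) / ((2 * m + 3 * k' + 2).choose (m + k') : ℚ)
        - (∑ i ∈ range (m + 1), ((2 * m + k').choose i : ℚ)) / ((2 * m + k').choose m : ℚ)
        - ∑ j ∈ range (k' + 1), ((2 * k' + 2).choose (k' + 2 + j) : ℚ)
            * ∑ a ∈ range (m + 1), (m.choose a : ℚ) / ((m + k' + (k' + 2 + j) + a).choose (a + (k' + 2 + j)) : ℚ) := by
  -- the binomial sum over j ≤ 2k'+2 = S₀(q, m + 2k' + 2)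
  have hb := slice_binom_sum (m + k') m (2 * k' + 2) 0
  simp only [zero_add] at hb
  -- split it: j = 0, then j = 1 … k'+1 (L), then j = k'+2 … 2k'+2 (T)
  rw [Finset.sum_range_succ' (fun j => ((2 * k' + 2).choose j : ℚ)
      * ∑ a ∈ range (m + 1), (m.choose a : ℚ) / ((m + k' + j + a).choose (a + j) : ℚ)) (2 * k' + 2),
    show 2 * k' + 2 = (k' + 1) + (k' + 1) by ring, Finset.sum_range_add] at hb
  simp only [Nat.choose_zero_right, Nat.cast_one, one_mul, show (k' + 1) + (k' + 1) = 2 * k' + 2 by ring] at hb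
  -- the three S₀ / ρ forms
  have hS0 : ∑ a ∈ range (m + 1), (m.choose a : ℚ) / ((m + k' + 0 + a).choose (a + 0) : ℚ)
      = (∑ i ∈ range (m + 1), ((2 * m + k').choose i : ℚ)) / ((2 * m + k').choose m : ℚ) := by
    rw [slice_zero_eq_rho, show m + k' + m = 2 * m + k' by ring]
  have hS1 : ∑ a ∈ range (m + (2 * k' + 2) + 1), ((m + (2 * k' + 2)).choose a : ℚ) / ((m + k' + 0 + a).choose (a + 0) : ℚ)
      = (∑ i ∈ range (m + (2 * k' + 2) + 1), ((2 * m + 3 * k' + 2).choose i : ℚ))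
          / ((2 * m + 3 * k' + 2).choose (m + (2 * k' + 2)) : ℚ) := by
    rw [slice_zero_eq_rho, show m + k' + (m + (2 * k' + 2)) = 2 * m + 3 * k' + 2 by ring]
  -- Φ with the same denominator: C(2q+k, q+k) = C(2q+k, q)
  have hphi : phiK (m + k' + (k' + 2)) (m + k')
      = (∑ i ∈ Ioo (m + k') (m + (2 * k' + 2)), ((2 * m + 3 * k' + 2).choose i : ℚ))
          / ((2 * m + 3 * k' + 2).choose (m + (2 * k' + 2)) : ℚ) := by
    unfold phiK
    rw [show m + k' + (k' + 2) + (m + k') = 2 * m + 3 * k' + 2 by ring,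
      show m + k' + (k' + 2) = m + (2 * k' + 2) by ring]
  have hsym : ((2 * m + 3 * k' + 2).choose (m + (2 * k' + 2)) : ℚ) = ((2 * m + 3 * k' + 2).choose (m + k') : ℚ) := by
    rw [show 2 * m + 3 * k' + 2 = (m + k') + (m + (2 * k' + 2)) by ring, Nat.choose_symm_add]
  have hnum := sum_choose_split_middle (2 * m + 3 * k' + 2) (m + k') (k' + 2) (by omega)
  rw [show m + k' + (k' + 2) = m + (2 * k' + 2) by ring] at hnum
  have hCpos : (0 : ℚ) < ((2 * m + 3 * k' + 2).choose (m + k') : ℚ) := by exact_mod_cast Nat.choose_pos (by omega)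
  -- the index forms of L and T inside hb
  have hT : ∑ j ∈ range (k' + 1), ((2 * k' + 2).choose (k' + 1 + j + 1) : ℚ)
        * ∑ a ∈ range (m + 1), (m.choose a : ℚ) / ((m + k' + (k' + 1 + j + 1) + a).choose (a + (k' + 1 + j + 1)) : ℚ)
      = ∑ j ∈ range (k' + 1), ((2 * k' + 2).choose (k' + 2 + j) : ℚ)
        * ∑ a ∈ range (m + 1), (m.choose a : ℚ) / ((m + k' + (k' + 2 + j) + a).choose (a + (k' + 2 + j)) : ℚ) :=
    Finset.sum_congr rfl (fun j _ => by rw [show k' + 1 + j + 1 = k' + 2 + j by ring])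
  rw [hT, hS0, hS1, hsym] at hb
  rw [hphi, hsym]
  -- assemble: L = S₀(q, q+k) − S₀(q, m) − T, and S₀(q, q+k) − Φ = 1 + ρ(2q+k, q)
  have key : (∑ i ∈ range (m + (2 * k' + 2) + 1), ((2 * m + 3 * k' + 2).choose i : ℚ))
          / ((2 * m + 3 * k' + 2).choose (m + k') : ℚ)
        - (∑ i ∈ Ioo (m + k') (m + (2 * k' + 2)), ((2 * m + 3 * k' + 2).choose i : ℚ))
          / ((2 * m + 3 * k' + 2).choose (m + k') : ℚ)
      = 1 + (∑ i ∈ range (m + k' + 1), ((2 * m + 3 * k' + 2).choose i : ℚ)) / ((2 * m + 3 * k' + 2).choose (m + k') : ℚ) := by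
    rw [← sub_div, hnum, hsym, add_div, div_self hCpos.ne']
    ring
  linarith [hb, key]

/-- **The borderline (R̂) from the partial-row-sum inequality**: if `T(q, k) ≤ 1 + ρ(2q+k, q) − ρ(2q−k+2, q−k+2)` then
`Φ(q+k, q) ≤ R̂(q, k, q−k+2)` (`k = k' + 2`, `q = m + k'`). The uniform borderline conjecture of record (dossier §28.7) is
therefore implied by the inequality between two partial row sums of Pascal's triangle, up to the tail `T`. -/
theorem phiK_le_rhat_border_of_rho (m k' : ℕ)
    (h : ∑ j ∈ range (k' + 1), ((2 * k' + 2).choose (k' + 2 + j) : ℚ)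
            * ∑ a ∈ range (m + 1), (m.choose a : ℚ) / ((m + k' + (k' + 2 + j) + a).choose (a + (k' + 2 + j)) : ℚ)
          ≤ 1 + (∑ i ∈ range (m + k' + 1), ((2 * m + 3 * k' + 2).choose i : ℚ)) / ((2 * m + 3 * k' + 2).choose (m + k') : ℚ)
            - (∑ i ∈ range (m + 1), ((2 * m + k').choose i : ℚ)) / ((2 * m + k').choose m : ℚ)) :
    phiK (m + k' + (k' + 2)) (m + k') ≤ rhat (m + k') (k' + 2) m := by
  have hid := border_sub_phiK_eq m k'
  have hL := rhatSliceL_le_rhat (m + k') (k' + 2) m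
  rw [sum_Ioo_nat, show k' + 2 - (0 + 1) = k' + 1 by omega, show m + k' + (k' + 2) - m = 2 * k' + 2 by omega] at hL
  simp only [zero_add] at hL
  have hre : ∑ j ∈ range (k' + 1), ((2 * k' + 2).choose (1 + j) : ℚ)
        * ∑ a ∈ range (m + 1), (m.choose a : ℚ) / ((m + k' + (1 + j) + a).choose (a + (1 + j)) : ℚ)
      = ∑ j ∈ range (k' + 1), ((2 * k' + 2).choose (j + 1) : ℚ)
        * ∑ a ∈ range (m + 1), (m.choose a : ℚ) / ((m + k' + (j + 1) + a).choose (a + (j + 1)) : ℚ) :=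
    Finset.sum_congr rfl (fun j _ => by rw [Nat.add_comm 1 j])
  rw [hre] at hL
  linarith [hid, hL, h]

end PercRepro
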